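import Summits.CriticalPhenomena.PercolationContinuityZ3.Theorems.PercNearOneGluingNoHeavyLowerTailThreePointProductFormHubWordsForms
import Summits.CriticalPhenomena.PercolationContinuityZ3.Theorems.PercNearOneGluingNoHeavyLowerTailThreePointProductFormHubWordsForms2
import Summits.CriticalPhenomena.PercolationContinuityZ3.Theorems.PercNearOneGluingNoHeavyLowerTailThreePointProductFormHubWordsCurvePairing
import Mathlib.Data.Fin.VecNotation
import Mathlib.Tactic.Linarith
import Mathlib.Tactic.NormNum
import Mathlib.Tactic.Ring
import Mathlib.Tactic.Positivity
import HarnessLib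

/-!
# Hub words over ℕ, IV: integer vertex tables and the monotonicity of the pairings `K_i` in both letters (THEOREM M, pencil families (P2)–(P4))
# (Sahi programme, prover prim-sahi-p2 gen 64; memo `FROM-prim-sahi-p2-gen64-ABPLUS-PROOF.md` §12)

Support file (`--supports stmt-CriticalPhenomena-4575`).  Standard axioms, no sorries, no named facts.  For each generator `g_i` (i = 0..4) of the
operator-amplitude cone of part II: `K_i(a+1,y) ≥ K_i(a,y)` (P2), `K_i(a,y+1) ≥ K_i(a,y)` (P3) and the mixed second difference `≥ 0` (P4), for ALL
`a, y ∈ ℕ` — each difference is a curve pairing `curve(w,a)ᵀ (QZ_i/den_i) curve(w′,y)` with `w, w′ ∈ {(1,1,1,1), (0,1,3,4)}`, and `pairing_curve_nonneg`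
(part III) reduces it to a 16 × 16 integer table checked by `decide` (256 kernel evaluations each). [this work]
-/

namespace Summit.CriticalPhenomena.PercolationContinuityZ3.Theorems.ProductFormHubWords

/-- `2·Q_0` as an integer matrix (rows: jump-letter pencil `a`, columns: state pencil `y`). [this work] -/
def QZ0 : Fin 4 → Fin 4 → ℤ := ![![(9 : ℤ), (-54 : ℤ), (-18 : ℤ), (27 : ℤ)], ![(-54 : ℤ), (144 : ℤ), (0 : ℤ), (-18 : ℤ)], ![(-18 : ℤ), (0 : ℤ), (0 : ℤ), (-54 : ℤ)], ![(27 : ℤ), (-18 : ℤ), (-54 : ℤ), (81 : ℤ)]]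

/-- `K_0` is the curve pairing of `QZ0/2`. [this work] -/
theorem K0_eq_BQ (a y : ℕ) : K0 a y = BQ QZ0 2 (curve wAZ a) (curve wAZ y) := by
  simp only [K0, BQ, curve, QZ0, wAZ, Matrix.cons_val_zero, Matrix.cons_val_one, Matrix.cons_val]
  push_cast
  ring

/-- jump-side first difference of `K_0` as a curve pairing. [this work] -/
theorem K0_diff_a (a y : ℕ) : K0 (a+1) y - K0 a y = BQ QZ0 2 (curve wDZ a) (curve wAZ y) := by
  simp only [K0, BQ, curve, QZ0, wAZ, wDZ, Matrix.cons_val_zero, Matrix.cons_val_one, Matrix.cons_val, pow_succ]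
  push_cast
  ring

/-- state-side first difference of `K_0` as a curve pairing. [this work] -/
theorem K0_diff_y (a y : ℕ) : K0 a (y+1) - K0 a y = BQ QZ0 2 (curve wAZ a) (curve wDZ y) := by
  simp only [K0, BQ, curve, QZ0, wAZ, wDZ, Matrix.cons_val_zero, Matrix.cons_val_one, Matrix.cons_val, pow_succ]
  push_cast
  ring

/-- mixed second difference of `K_0` as a curve pairing. [this work] -/
theorem K0_diff_ay (a y : ℕ) : (K0 (a+1) (y+1) - K0 a (y+1)) - (K0 (a+1) y - K0 a y) = BQ QZ0 2 (curve wDZ a) (curve wDZ y) := by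
  simp only [K0, BQ, curve, QZ0, wDZ, Matrix.cons_val_zero, Matrix.cons_val_one, Matrix.cons_val, pow_succ]
  push_cast
  ring

/-- integer vertex table (difference curve, pencil curve) for `g_0`. [this work] -/
theorem tabZ_DW0 : ∀ i j : Fin 16, 0 ≤ BZ QZ0 (vertZ wDZ i) (vertZ wAZ j) := by decide

/-- integer vertex table (pencil curve, difference curve) for `g_0`. [this work] -/
theorem tabZ_WD0 : ∀ i j : Fin 16, 0 ≤ BZ QZ0 (vertZ wAZ i) (vertZ wDZ j) := by decide

/-- integer vertex table (difference curve, difference curve) for `g_0`. [this work] -/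
theorem tabZ_DD0 : ∀ i j : Fin 16, 0 ≤ BZ QZ0 (vertZ wDZ i) (vertZ wDZ j) := by decide

/-- (P2) for `g_0`: `K_0(a+1,y) ≥ K_0(a,y)` for all `a, y ∈ ℕ`. [this work] -/
theorem K0_mono_a (a y : ℕ) : 0 ≤ K0 (a+1) y - K0 a y := by
  rw [K0_diff_a]; exact pairing_curve_nonneg QZ0 2 (by norm_num) wDZ wAZ tabZ_DW0 a y

/-- (P3) for `g_0`: `K_0(a,y+1) ≥ K_0(a,y)` for all `a, y ∈ ℕ`. [this work] -/
theorem K0_mono_y (a y : ℕ) : 0 ≤ K0 a (y+1) - K0 a y := by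
  rw [K0_diff_y]; exact pairing_curve_nonneg QZ0 2 (by norm_num) wAZ wDZ tabZ_WD0 a y

/-- (P4) for `g_0`: the mixed second difference of `K_0` is `≥ 0` for all `a, y ∈ ℕ`. [this work] -/
theorem K0_mono_ay (a y : ℕ) : 0 ≤ (K0 (a+1) (y+1) - K0 a (y+1)) - (K0 (a+1) y - K0 a y) := by
  rw [K0_diff_ay]; exact pairing_curve_nonneg QZ0 2 (by norm_num) wDZ wDZ tabZ_DD0 a y

/-- `2·Q_1` as an integer matrix (rows: jump-letter pencil `a`, columns: state pencil `y`). [this work] -/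
def QZ1 : Fin 4 → Fin 4 → ℤ := ![![(27 : ℤ), (-18 : ℤ), (-54 : ℤ), (81 : ℤ)], ![(-18 : ℤ), (0 : ℤ), (72 : ℤ), (-54 : ℤ)], ![(-54 : ℤ), (72 : ℤ), (0 : ℤ), (-162 : ℤ)], ![(81 : ℤ), (-54 : ℤ), (-162 : ℤ), (243 : ℤ)]]

/-- `K_1` is the curve pairing of `QZ1/2`. [this work] -/
theorem K1_eq_BQ (a y : ℕ) : K1 a y = BQ QZ1 2 (curve wAZ a) (curve wAZ y) := by
  simp only [K1, BQ, curve, QZ1, wAZ, Matrix.cons_val_zero, Matrix.cons_val_one, Matrix.cons_val]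
  push_cast
  ring

/-- jump-side first difference of `K_1` as a curve pairing. [this work] -/
theorem K1_diff_a (a y : ℕ) : K1 (a+1) y - K1 a y = BQ QZ1 2 (curve wDZ a) (curve wAZ y) := by
  simp only [K1, BQ, curve, QZ1, wAZ, wDZ, Matrix.cons_val_zero, Matrix.cons_val_one, Matrix.cons_val, pow_succ]
  push_cast
  ring

/-- state-side first difference of `K_1` as a curve pairing. [this work] -/
theorem K1_diff_y (a y : ℕ) : K1 a (y+1) - K1 a y = BQ QZ1 2 (curve wAZ a) (curve wDZ y) := by
  simp only [K1, BQ, curve, QZ1, wAZ, wDZ, Matrix.cons_val_zero, Matrix.cons_val_one, Matrix.cons_val, pow_succ]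
  push_cast
  ring

/-- mixed second difference of `K_1` as a curve pairing. [this work] -/
theorem K1_diff_ay (a y : ℕ) : (K1 (a+1) (y+1) - K1 a (y+1)) - (K1 (a+1) y - K1 a y) = BQ QZ1 2 (curve wDZ a) (curve wDZ y) := by
  simp only [K1, BQ, curve, QZ1, wDZ, Matrix.cons_val_zero, Matrix.cons_val_one, Matrix.cons_val, pow_succ]
  push_cast
  ring

/-- integer vertex table (difference curve, pencil curve) for `g_1`. [this work] -/
theorem tabZ_DW1 : ∀ i j : Fin 16, 0 ≤ BZ QZ1 (vertZ wDZ i) (vertZ wAZ j) := by decide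

/-- integer vertex table (pencil curve, difference curve) for `g_1`. [this work] -/
theorem tabZ_WD1 : ∀ i j : Fin 16, 0 ≤ BZ QZ1 (vertZ wAZ i) (vertZ wDZ j) := by decide

/-- integer vertex table (difference curve, difference curve) for `g_1`. [this work] -/
theorem tabZ_DD1 : ∀ i j : Fin 16, 0 ≤ BZ QZ1 (vertZ wDZ i) (vertZ wDZ j) := by decide

/-- (P2) for `g_1`: `K_1(a+1,y) ≥ K_1(a,y)` for all `a, y ∈ ℕ`. [this work] -/
theorem K1_mono_a (a y : ℕ) : 0 ≤ K1 (a+1) y - K1 a y := by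
  rw [K1_diff_a]; exact pairing_curve_nonneg QZ1 2 (by norm_num) wDZ wAZ tabZ_DW1 a y

/-- (P3) for `g_1`: `K_1(a,y+1) ≥ K_1(a,y)` for all `a, y ∈ ℕ`. [this work] -/
theorem K1_mono_y (a y : ℕ) : 0 ≤ K1 a (y+1) - K1 a y := by
  rw [K1_diff_y]; exact pairing_curve_nonneg QZ1 2 (by norm_num) wAZ wDZ tabZ_WD1 a y

/-- (P4) for `g_1`: the mixed second difference of `K_1` is `≥ 0` for all `a, y ∈ ℕ`. [this work] -/
theorem K1_mono_ay (a y : ℕ) : 0 ≤ (K1 (a+1) (y+1) - K1 a (y+1)) - (K1 (a+1) y - K1 a y) := by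
  rw [K1_diff_ay]; exact pairing_curve_nonneg QZ1 2 (by norm_num) wDZ wDZ tabZ_DD1 a y

/-- `1·Q_2` as an integer matrix (rows: jump-letter pencil `a`, columns: state pencil `y`). [this work] -/
def QZ2 : Fin 4 → Fin 4 → ℤ := ![![(-18 : ℤ), (36 : ℤ), (-18 : ℤ), (-18 : ℤ)], ![(36 : ℤ), (-72 : ℤ), (36 : ℤ), (36 : ℤ)], ![(-18 : ℤ), (36 : ℤ), (0 : ℤ), (-54 : ℤ)], ![(-18 : ℤ), (36 : ℤ), (-54 : ℤ), (54 : ℤ)]]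

/-- `K_2` is the curve pairing of `QZ2/1`. [this work] -/
theorem K2_eq_BQ (a y : ℕ) : K2 a y = BQ QZ2 1 (curve wAZ a) (curve wAZ y) := by
  simp only [K2, BQ, curve, QZ2, wAZ, Matrix.cons_val_zero, Matrix.cons_val_one, Matrix.cons_val]
  push_cast
  ring

/-- jump-side first difference of `K_2` as a curve pairing. [this work] -/
theorem K2_diff_a (a y : ℕ) : K2 (a+1) y - K2 a y = BQ QZ2 1 (curve wDZ a) (curve wAZ y) := by
  simp only [K2, BQ, curve, QZ2, wAZ, wDZ, Matrix.cons_val_zero, Matrix.cons_val_one, Matrix.cons_val, pow_succ]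
  push_cast
  ring

/-- state-side first difference of `K_2` as a curve pairing. [this work] -/
theorem K2_diff_y (a y : ℕ) : K2 a (y+1) - K2 a y = BQ QZ2 1 (curve wAZ a) (curve wDZ y) := by
  simp only [K2, BQ, curve, QZ2, wAZ, wDZ, Matrix.cons_val_zero, Matrix.cons_val_one, Matrix.cons_val, pow_succ]
  push_cast
  ring

/-- mixed second difference of `K_2` as a curve pairing. [this work] -/
theorem K2_diff_ay (a y : ℕ) : (K2 (a+1) (y+1) - K2 a (y+1)) - (K2 (a+1) y - K2 a y) = BQ QZ2 1 (curve wDZ a) (curve wDZ y) := by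
  simp only [K2, BQ, curve, QZ2, wDZ, Matrix.cons_val_zero, Matrix.cons_val_one, Matrix.cons_val, pow_succ]
  push_cast
  ring

/-- integer vertex table (difference curve, pencil curve) for `g_2`. [this work] -/
theorem tabZ_DW2 : ∀ i j : Fin 16, 0 ≤ BZ QZ2 (vertZ wDZ i) (vertZ wAZ j) := by decide

/-- integer vertex table (pencil curve, difference curve) for `g_2`. [this work] -/
theorem tabZ_WD2 : ∀ i j : Fin 16, 0 ≤ BZ QZ2 (vertZ wAZ i) (vertZ wDZ j) := by decide

/-- integer vertex table (difference curve, difference curve) for `g_2`. [this work] -/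
theorem tabZ_DD2 : ∀ i j : Fin 16, 0 ≤ BZ QZ2 (vertZ wDZ i) (vertZ wDZ j) := by decide

/-- (P2) for `g_2`: `K_2(a+1,y) ≥ K_2(a,y)` for all `a, y ∈ ℕ`. [this work] -/
theorem K2_mono_a (a y : ℕ) : 0 ≤ K2 (a+1) y - K2 a y := by
  rw [K2_diff_a]; exact pairing_curve_nonneg QZ2 1 (by norm_num) wDZ wAZ tabZ_DW2 a y

/-- (P3) for `g_2`: `K_2(a,y+1) ≥ K_2(a,y)` for all `a, y ∈ ℕ`. [this work] -/
theorem K2_mono_y (a y : ℕ) : 0 ≤ K2 a (y+1) - K2 a y := by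
  rw [K2_diff_y]; exact pairing_curve_nonneg QZ2 1 (by norm_num) wAZ wDZ tabZ_WD2 a y

/-- (P4) for `g_2`: the mixed second difference of `K_2` is `≥ 0` for all `a, y ∈ ℕ`. [this work] -/
theorem K2_mono_ay (a y : ℕ) : 0 ≤ (K2 (a+1) (y+1) - K2 a (y+1)) - (K2 (a+1) y - K2 a y) := by
  rw [K2_diff_ay]; exact pairing_curve_nonneg QZ2 1 (by norm_num) wDZ wDZ tabZ_DD2 a y

/-- `1·Q_3` as an integer matrix (rows: jump-letter pencil `a`, columns: state pencil `y`). [this work] -/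
def QZ3 : Fin 4 → Fin 4 → ℤ := ![![(-18 : ℤ), (36 : ℤ), (-36 : ℤ), (-54 : ℤ)], ![(36 : ℤ), (-72 : ℤ), (72 : ℤ), (108 : ℤ)], ![(-54 : ℤ), (72 : ℤ), (0 : ℤ), (-162 : ℤ)], ![(54 : ℤ), (-36 : ℤ), (-108 : ℤ), (162 : ℤ)]]

/-- `K_3` is the curve pairing of `QZ3/1`. [this work] -/
theorem K3_eq_BQ (a y : ℕ) : K3 a y = BQ QZ3 1 (curve wAZ a) (curve wAZ y) := by
  simp only [K3, BQ, curve, QZ3, wAZ, Matrix.cons_val_zero, Matrix.cons_val_one, Matrix.cons_val]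
  push_cast
  ring

/-- jump-side first difference of `K_3` as a curve pairing. [this work] -/
theorem K3_diff_a (a y : ℕ) : K3 (a+1) y - K3 a y = BQ QZ3 1 (curve wDZ a) (curve wAZ y) := by
  simp only [K3, BQ, curve, QZ3, wAZ, wDZ, Matrix.cons_val_zero, Matrix.cons_val_one, Matrix.cons_val, pow_succ]
  push_cast
  ring

/-- state-side first difference of `K_3` as a curve pairing. [this work] -/
theorem K3_diff_y (a y : ℕ) : K3 a (y+1) - K3 a y = BQ QZ3 1 (curve wAZ a) (curve wDZ y) := by
  simp only [K3, BQ, curve, QZ3, wAZ, wDZ, Matrix.cons_val_zero, Matrix.cons_val_one, Matrix.cons_val, pow_succ]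
  push_cast
  ring

/-- mixed second difference of `K_3` as a curve pairing. [this work] -/
theorem K3_diff_ay (a y : ℕ) : (K3 (a+1) (y+1) - K3 a (y+1)) - (K3 (a+1) y - K3 a y) = BQ QZ3 1 (curve wDZ a) (curve wDZ y) := by
  simp only [K3, BQ, curve, QZ3, wDZ, Matrix.cons_val_zero, Matrix.cons_val_one, Matrix.cons_val, pow_succ]
  push_cast
  ring

/-- integer vertex table (difference curve, pencil curve) for `g_3`. [this work] -/
theorem tabZ_DW3 : ∀ i j : Fin 16, 0 ≤ BZ QZ3 (vertZ wDZ i) (vertZ wAZ j) := by decide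

/-- integer vertex table (pencil curve, difference curve) for `g_3`. [this work] -/
theorem tabZ_WD3 : ∀ i j : Fin 16, 0 ≤ BZ QZ3 (vertZ wAZ i) (vertZ wDZ j) := by decide

/-- integer vertex table (difference curve, difference curve) for `g_3`. [this work] -/
theorem tabZ_DD3 : ∀ i j : Fin 16, 0 ≤ BZ QZ3 (vertZ wDZ i) (vertZ wDZ j) := by decide

/-- (P2) for `g_3`: `K_3(a+1,y) ≥ K_3(a,y)` for all `a, y ∈ ℕ`. [this work] -/
theorem K3_mono_a (a y : ℕ) : 0 ≤ K3 (a+1) y - K3 a y := by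
  rw [K3_diff_a]; exact pairing_curve_nonneg QZ3 1 (by norm_num) wDZ wAZ tabZ_DW3 a y

/-- (P3) for `g_3`: `K_3(a,y+1) ≥ K_3(a,y)` for all `a, y ∈ ℕ`. [this work] -/
theorem K3_mono_y (a y : ℕ) : 0 ≤ K3 a (y+1) - K3 a y := by
  rw [K3_diff_y]; exact pairing_curve_nonneg QZ3 1 (by norm_num) wAZ wDZ tabZ_WD3 a y

/-- (P4) for `g_3`: the mixed second difference of `K_3` is `≥ 0` for all `a, y ∈ ℕ`. [this work] -/
theorem K3_mono_ay (a y : ℕ) : 0 ≤ (K3 (a+1) (y+1) - K3 a (y+1)) - (K3 (a+1) y - K3 a y) := by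
  rw [K3_diff_ay]; exact pairing_curve_nonneg QZ3 1 (by norm_num) wDZ wDZ tabZ_DD3 a y

/-- `1·Q_4` as an integer matrix (rows: jump-letter pencil `a`, columns: state pencil `y`). [this work] -/
def QZ4 : Fin 4 → Fin 4 → ℤ := ![![(-18 : ℤ), (36 : ℤ), (-54 : ℤ), (54 : ℤ)], ![(36 : ℤ), (-72 : ℤ), (72 : ℤ), (-36 : ℤ)], ![(-36 : ℤ), (72 : ℤ), (0 : ℤ), (-108 : ℤ)], ![(-54 : ℤ), (108 : ℤ), (-162 : ℤ), (162 : ℤ)]]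

/-- `K_4` is the curve pairing of `QZ4/1`. [this work] -/
theorem K4_eq_BQ (a y : ℕ) : K4 a y = BQ QZ4 1 (curve wAZ a) (curve wAZ y) := by
  simp only [K4, BQ, curve, QZ4, wAZ, Matrix.cons_val_zero, Matrix.cons_val_one, Matrix.cons_val]
  push_cast
  ring

/-- jump-side first difference of `K_4` as a curve pairing. [this work] -/
theorem K4_diff_a (a y : ℕ) : K4 (a+1) y - K4 a y = BQ QZ4 1 (curve wDZ a) (curve wAZ y) := by
  simp only [K4, BQ, curve, QZ4, wAZ, wDZ, Matrix.cons_val_zero, Matrix.cons_val_one, Matrix.cons_val, pow_succ]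
  push_cast
  ring

/-- state-side first difference of `K_4` as a curve pairing. [this work] -/
theorem K4_diff_y (a y : ℕ) : K4 a (y+1) - K4 a y = BQ QZ4 1 (curve wAZ a) (curve wDZ y) := by
  simp only [K4, BQ, curve, QZ4, wAZ, wDZ, Matrix.cons_val_zero, Matrix.cons_val_one, Matrix.cons_val, pow_succ]
  push_cast
  ring

/-- mixed second difference of `K_4` as a curve pairing. [this work] -/
theorem K4_diff_ay (a y : ℕ) : (K4 (a+1) (y+1) - K4 a (y+1)) - (K4 (a+1) y - K4 a y) = BQ QZ4 1 (curve wDZ a) (curve wDZ y) := by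
  simp only [K4, BQ, curve, QZ4, wDZ, Matrix.cons_val_zero, Matrix.cons_val_one, Matrix.cons_val, pow_succ]
  push_cast
  ring

/-- integer vertex table (difference curve, pencil curve) for `g_4`. [this work] -/
theorem tabZ_DW4 : ∀ i j : Fin 16, 0 ≤ BZ QZ4 (vertZ wDZ i) (vertZ wAZ j) := by decide

/-- integer vertex table (pencil curve, difference curve) for `g_4`. [this work] -/
theorem tabZ_WD4 : ∀ i j : Fin 16, 0 ≤ BZ QZ4 (vertZ wAZ i) (vertZ wDZ j) := by decide

/-- integer vertex table (difference curve, difference curve) for `g_4`. [this work] -/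
theorem tabZ_DD4 : ∀ i j : Fin 16, 0 ≤ BZ QZ4 (vertZ wDZ i) (vertZ wDZ j) := by decide

/-- (P2) for `g_4`: `K_4(a+1,y) ≥ K_4(a,y)` for all `a, y ∈ ℕ`. [this work] -/
theorem K4_mono_a (a y : ℕ) : 0 ≤ K4 (a+1) y - K4 a y := by
  rw [K4_diff_a]; exact pairing_curve_nonneg QZ4 1 (by norm_num) wDZ wAZ tabZ_DW4 a y

/-- (P3) for `g_4`: `K_4(a,y+1) ≥ K_4(a,y)` for all `a, y ∈ ℕ`. [this work] -/
theorem K4_mono_y (a y : ℕ) : 0 ≤ K4 a (y+1) - K4 a y := by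
  rw [K4_diff_y]; exact pairing_curve_nonneg QZ4 1 (by norm_num) wAZ wDZ tabZ_WD4 a y

/-- (P4) for `g_4`: the mixed second difference of `K_4` is `≥ 0` for all `a, y ∈ ℕ`. [this work] -/
theorem K4_mono_ay (a y : ℕ) : 0 ≤ (K4 (a+1) (y+1) - K4 a (y+1)) - (K4 (a+1) y - K4 a y) := by
  rw [K4_diff_ay]; exact pairing_curve_nonneg QZ4 1 (by norm_num) wDZ wDZ tabZ_DD4 a y

end Summit.CriticalPhenomena.PercolationContinuityZ3.Theorems.ProductFormHubWords
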